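import Literature.NumberTheory.Sieve.SelbergSieveOptionBox
import Literature.NumberTheory.Sieve.SelbergSieveGBoxBounds
import HarnessLib

/-!
# The coupling sum of Maynard's Proposition 9.4: support and size

Source: J. Maynard, *Dense clusters of primes in subsets*, Compositio Math. 152 (2016) =
arXiv:1405.2593 [Maynard2016DenseClusters], proof of Proposition 9.4 pp. 25–26 (P94-SPEC §1d′).

For the coupling sum `B(r⁺; g, g₀)` of `SelbergSieveOptionBox` (`r⁺ = (r, r₀)`, `r ∣ g ∈ box`,
`r₀ ∣ g₀` square-free) write `C := primes(∏ g) ∖ primes(∏ r)` and `C₀ := primes(g₀) ∖ primes(r₀)`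
for the "fresh" primes. This file proves
* **`couplingB_eq_zero_of_not_subset_left/right`** — `B ≠ 0` forces `C ⊆ primes(g₀)` and
  `C₀ ⊆ primes(∏ g)` (contrapositives of the toggling lemmas);
* `apply_eq_gcd_prod`, `card_interval_le`, `card_divisors_filter_dvd_le` — a coordinatewise divisor
  `f` of `g ∈ box` is determined by `∏ f` (`f_j = (∏ f, g_j)`), whence
  `#{f ∈ box : r ∣ f ∣ g} ≤ 2^{#C}` and `#{f₀ ∣ g₀ : r₀ ∣ f₀} ≤ 2^{#C₀}`;
* **`abs_couplingB_le_two_pow`** — `|B(r⁺; g, g₀)| ≤ 2^{#C} · 2^{#C₀}`.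

## References
* J. Maynard, *Dense clusters of primes in subsets*, Compositio Math. 152 (2016), proof of Prop. 9.4
  pp. 25–26 [Maynard2016DenseClusters].
-/

noncomputable section

open Finset
open scoped ArithmeticFunction.Moebius

namespace Literature.NumberTheory.Sieve.SelbergBox

variable {κ : Type*} [Fintype κ] [DecidableEq κ]

/-! ### Support of the coupling sum -/

/-- If some fresh prime of `g` (dividing `∏ g` but not `∏ r`) does not divide `g₀`, then
`B(r⁺; g, g₀) = 0`. [cite: Maynard2016DenseClusters, proof of Prop. 9.4 pp. 25–26] -/
theorem couplingB_eq_zero_of_not_subset_left {N₁ W₁ : κ → ℕ} {r : Option κ → ℕ} {g : κ → ℕ}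
    {g₀ : ℕ} (hg : g ∈ gBox N₁ W₁) (hrg : ∀ i, r (some i) ∣ g i) (hg₀ : g₀ ≠ 0)
    (h : ¬ (∏ j, g j).primeFactors \ (∏ j, r (some j)).primeFactors ⊆ g₀.primeFactors) :
    couplingB N₁ W₁ r g g₀ = 0 := by
  obtain ⟨p, hp1, hp2⟩ := Finset.not_subset.1 h
  obtain ⟨hpg, hpr⟩ := Finset.mem_sdiff.1 hp1
  have hp : p.Prime := Nat.prime_of_mem_primeFactors hpg
  have hr0 : (∏ j, r (some j)) ≠ 0 := Finset.prod_ne_zero_iff.2 fun j _ h0 => by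
    have h1 := hrg j
    rw [h0, zero_dvd_iff] at h1
    exact absurd h1 (by have := one_le_of_mem_gBox hg j; omega)
  obtain ⟨j, -, hpj⟩ := (hp.prime.dvd_finsetProd_iff _).1 (Nat.dvd_of_mem_primeFactors hpg)
  have hprj : ¬ p ∣ r (some j) := fun hd =>
    hpr (Nat.mem_primeFactors.2 ⟨hp, hd.trans (Finset.dvd_prod_of_mem _ (Finset.mem_univ j)), hr0⟩)
  have hpg₀ : ¬ p ∣ g₀ := fun hd => hp2 (Nat.mem_primeFactors.2 ⟨hp, hd, hg₀⟩)
  exact couplingB_eq_zero_left hg hp hpj hprj hpg₀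

/-- If some fresh prime of `g₀` (dividing `g₀` but not `r₀`) does not divide `∏ g`, then
`B(r⁺; g, g₀) = 0`. [cite: Maynard2016DenseClusters, proof of Prop. 9.4 pp. 25–26] -/
theorem couplingB_eq_zero_of_not_subset_right {N₁ W₁ : κ → ℕ} {r : Option κ → ℕ} {g : κ → ℕ}
    {g₀ : ℕ} (hg : g ∈ gBox N₁ W₁) (hg₀ : Squarefree g₀) (hr₀ : r none ∣ g₀)
    (h : ¬ g₀.primeFactors \ (r none).primeFactors ⊆ (∏ j, g j).primeFactors) :
    couplingB N₁ W₁ r g g₀ = 0 := by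
  obtain ⟨p, hp1, hp2⟩ := Finset.not_subset.1 h
  obtain ⟨hpg₀, hpr⟩ := Finset.mem_sdiff.1 hp1
  have hp : p.Prime := Nat.prime_of_mem_primeFactors hpg₀
  have hr0 : r none ≠ 0 := fun h0 => hg₀.ne_zero (by
    rw [h0, zero_dvd_iff] at hr₀; exact hr₀)
  have hprn : ¬ p ∣ r none := fun hd => hpr (Nat.mem_primeFactors.2 ⟨hp, hd, hr0⟩)
  have hpg : ¬ p ∣ ∏ j, g j := fun hd =>
    hp2 (Nat.mem_primeFactors.2 ⟨hp, hd, (squarefree_of_mem_gBox hg).ne_zero⟩)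
  exact couplingB_eq_zero_right hg₀ hp (Nat.dvd_of_mem_primeFactors hpg₀) hprn hpg

/-! ### Counting the intervals -/

omit [Fintype κ] [DecidableEq κ] in
/-- Square-free numbers are determined by their prime factors.
[cite: Maynard2016DenseClusters, §7 p. 13 (square-free variables of summation)] -/
theorem eq_of_squarefree_of_primeFactors_eq {m n : ℕ} (hm : Squarefree m) (hn : Squarefree n)
    (h : m.primeFactors = n.primeFactors) : m = n := by
  rw [← Nat.prod_primeFactors_of_squarefree hm, ← Nat.prod_primeFactors_of_squarefree hn, h]

/-- In the box a coordinatewise divisor `f` of `g` is determined by its product: `f_j = (∏ f, g_j)`.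
[cite: Maynard2016DenseClusters, §7 p. 13 (pairwise coprime square-free components)] -/
theorem apply_eq_gcd_prod {N W : κ → ℕ} {f g : κ → ℕ} (hg : g ∈ gBox N W) (hfg : ∀ i, f i ∣ g i)
    (j : κ) : f j = Nat.gcd (∏ i, f i) (g j) := by
  refine Nat.dvd_antisymm (Nat.dvd_gcd (Finset.dvd_prod_of_mem f (Finset.mem_univ j)) (hfg j)) ?_
  have hsplit : ∏ i, f i = f j * ∏ i ∈ Finset.univ.erase j, f i :=
    (Finset.mul_prod_erase Finset.univ f (Finset.mem_univ j)).symm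
  have hcop : (Nat.gcd (∏ i, f i) (g j)).Coprime (∏ i ∈ Finset.univ.erase j, f i) := by
    refine Nat.Coprime.prod_right fun i hi => ?_
    have hij : i ≠ j := Finset.ne_of_mem_erase hi
    exact Nat.Coprime.of_dvd (Nat.gcd_dvd_right _ _) (hfg i)
      (coprime_apply_of_mem_gBox hg (Ne.symm hij))
  have hdvd : Nat.gcd (∏ i, f i) (g j) ∣ f j * ∏ i ∈ Finset.univ.erase j, f i :=
    hsplit ▸ Nat.gcd_dvd_left _ _
  exact hcop.dvd_of_dvd_mul_right hdvd

/-- Hence `f ↦ ∏ f` is injective on the coordinatewise divisors of `g ∈ box`.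
[cite: Maynard2016DenseClusters, §7 p. 13] -/
theorem prod_injOn_dvd {N W : κ → ℕ} {g : κ → ℕ} (hg : g ∈ gBox N W) :
    Set.InjOn (fun f : κ → ℕ => ∏ i, f i) {f | ∀ i, f i ∣ g i} := by
  intro f hf f' hf' h
  funext j
  rw [apply_eq_gcd_prod hg hf j, apply_eq_gcd_prod hg hf' j]
  exact congrArg (fun n => Nat.gcd n (g j)) h

/-- `#{f ∈ box : r ∣ f ∣ g} ≤ 2^{#(primes(∏ g) ∖ primes(∏ r))}` (`f ↦ primes(∏ f) ∖ primes(∏ r)` is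
injective into the power set). [cite: Maynard2016DenseClusters, proof of Prop. 9.4 pp. 25–26] -/
theorem card_interval_le {N W : κ → ℕ} {r g : κ → ℕ} (hg : g ∈ gBox N W) :
    ((gBox N W).filter (fun f => (∀ i, r i ∣ f i) ∧ ∀ i, f i ∣ g i)).card ≤
      2 ^ ((∏ j, g j).primeFactors \ (∏ j, r j).primeFactors).card := by
  classical
  rw [← Finset.card_powerset]
  have hg0 : (∏ j, g j) ≠ 0 := (squarefree_of_mem_gBox hg).ne_zero
  refine Finset.card_le_card_of_injOn
    (fun f : κ → ℕ => (∏ j, f j).primeFactors \ (∏ j, r j).primeFactors) ?_ ?_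
  · intro f hf
    obtain ⟨-, -, hfg⟩ := Finset.mem_filter.1 (Finset.mem_coe.1 hf)
    refine Finset.mem_coe.2 (Finset.mem_powerset.2 (Finset.sdiff_subset_sdiff ?_ le_rfl))
    exact Nat.primeFactors_mono (Finset.prod_dvd_prod_of_dvd _ _ fun i _ => hfg i) hg0
  · intro f hf f' hf' h
    obtain ⟨-, hrf, hfg⟩ := Finset.mem_filter.1 (Finset.mem_coe.1 hf)
    obtain ⟨-, hrf', hf'g⟩ := Finset.mem_filter.1 (Finset.mem_coe.1 hf')
    have hf0 : (∏ j, f j) ≠ 0 := Finset.prod_ne_zero_iff.2 fun j _ h0 => by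
      have h1 := hfg j; rw [h0, zero_dvd_iff] at h1
      exact absurd h1 (by have := one_le_of_mem_gBox hg j; omega)
    have hf'0 : (∏ j, f' j) ≠ 0 := Finset.prod_ne_zero_iff.2 fun j _ h0 => by
      have h1 := hf'g j; rw [h0, zero_dvd_iff] at h1
      exact absurd h1 (by have := one_le_of_mem_gBox hg j; omega)
    have hsub : (∏ j, r j).primeFactors ⊆ (∏ j, f j).primeFactors :=
      Nat.primeFactors_mono (Finset.prod_dvd_prod_of_dvd _ _ fun i _ => hrf i) hf0
    have hsub' : (∏ j, r j).primeFactors ⊆ (∏ j, f' j).primeFactors :=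
      Nat.primeFactors_mono (Finset.prod_dvd_prod_of_dvd _ _ fun i _ => hrf' i) hf'0
    have hpf : (∏ j, f j).primeFactors = (∏ j, f' j).primeFactors := by
      rw [← Finset.union_sdiff_of_subset hsub, ← Finset.union_sdiff_of_subset hsub']
      exact congrArg _ h
    have hsqg := squarefree_of_mem_gBox hg
    have hprod : ∏ j, f j = ∏ j, f' j :=
      eq_of_squarefree_of_primeFactors_eq
        (hsqg.squarefree_of_dvd (Finset.prod_dvd_prod_of_dvd _ _ fun i _ => hfg i))
        (hsqg.squarefree_of_dvd (Finset.prod_dvd_prod_of_dvd _ _ fun i _ => hf'g i)) hpf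
    exact prod_injOn_dvd hg hfg hf'g hprod

omit [Fintype κ] [DecidableEq κ] in
/-- `#{f₀ ∣ g₀ : r₀ ∣ f₀} ≤ 2^{#(primes(g₀) ∖ primes(r₀))}` for square-free `g₀`.
[cite: Maynard2016DenseClusters, proof of Prop. 9.4 pp. 25–26] -/
theorem card_divisors_filter_dvd_le {g₀ r₀ : ℕ} (hg₀ : Squarefree g₀) :
    (g₀.divisors.filter (fun f₀ => r₀ ∣ f₀)).card ≤
      2 ^ (g₀.primeFactors \ r₀.primeFactors).card := by
  classical
  rw [← Finset.card_powerset]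
  refine Finset.card_le_card_of_injOn (fun f₀ : ℕ => f₀.primeFactors \ r₀.primeFactors) ?_ ?_
  · intro f₀ hf
    obtain ⟨hfd, -⟩ := Finset.mem_filter.1 (Finset.mem_coe.1 hf)
    refine Finset.mem_coe.2 (Finset.mem_powerset.2 (Finset.sdiff_subset_sdiff ?_ le_rfl))
    exact Nat.primeFactors_mono (Nat.mem_divisors.1 hfd).1 hg₀.ne_zero
  · intro f₀ hf f₀' hf' h
    obtain ⟨hfd, hrf⟩ := Finset.mem_filter.1 (Finset.mem_coe.1 hf)
    obtain ⟨hf'd, hrf'⟩ := Finset.mem_filter.1 (Finset.mem_coe.1 hf')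
    have hf0 : f₀ ≠ 0 := Nat.ne_of_gt (Nat.pos_of_mem_divisors hfd)
    have hf'0 : f₀' ≠ 0 := Nat.ne_of_gt (Nat.pos_of_mem_divisors hf'd)
    have hsub : r₀.primeFactors ⊆ f₀.primeFactors := Nat.primeFactors_mono hrf hf0
    have hsub' : r₀.primeFactors ⊆ f₀'.primeFactors := Nat.primeFactors_mono hrf' hf'0
    have hpf : f₀.primeFactors = f₀'.primeFactors := by
      rw [← Finset.union_sdiff_of_subset hsub, ← Finset.union_sdiff_of_subset hsub']
      exact congrArg _ h
    exact eq_of_squarefree_of_primeFactors_eq (hg₀.squarefree_of_dvd (Nat.mem_divisors.1 hfd).1)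
      (hg₀.squarefree_of_dvd (Nat.mem_divisors.1 hf'd).1) hpf

/-- **Size of the coupling sum**: `|B(r⁺; g, g₀)| ≤ 2^{#C} · 2^{#C₀}` with
`C = primes(∏ g) ∖ primes(∏ r)`, `C₀ = primes(g₀) ∖ primes(r₀)`.
[cite: Maynard2016DenseClusters, proof of Prop. 9.4 pp. 25–26] -/
theorem abs_couplingB_le_two_pow {N₁ W₁ : κ → ℕ} (r : Option κ → ℕ) {g : κ → ℕ} {g₀ : ℕ}
    (hg : g ∈ gBox N₁ W₁) (hg₀ : Squarefree g₀) :
    |couplingB N₁ W₁ r g g₀| ≤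
      (2 : ℝ) ^ ((∏ j, g j).primeFactors \ (∏ j, r (some j)).primeFactors).card *
        (2 : ℝ) ^ (g₀.primeFactors \ (r none).primeFactors).card := by
  refine (abs_couplingB_le N₁ W₁ r g g₀).trans ?_
  have h1 := card_interval_le (N := N₁) (W := W₁) (r := fun i => r (some i)) hg
  have h2 := card_divisors_filter_dvd_le (r₀ := r none) hg₀
  have h1' : (((gBox N₁ W₁).filter (fun f => (∀ i, r (some i) ∣ f i) ∧ ∀ i, f i ∣ g i)).card : ℝ) ≤
      (2 : ℝ) ^ ((∏ j, g j).primeFactors \ (∏ j, r (some j)).primeFactors).card := by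
    exact_mod_cast h1
  have h2' : ((g₀.divisors.filter (fun f₀ => r none ∣ f₀)).card : ℝ) ≤
      (2 : ℝ) ^ (g₀.primeFactors \ (r none).primeFactors).card := by
    exact_mod_cast h2
  exact mul_le_mul h1' h2' (by positivity) (by positivity)

end Literature.NumberTheory.Sieve.SelbergBox
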